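import Literature.MathematicalPhysics.QuantumFieldTheory.Balaban1983to89.B9B8KnitBondResolvent
import Literature.MathematicalPhysics.QuantumFieldTheory.Balaban1983to89.B9Thm310DeltaAIsUnitOfExpansion
import Literature.MathematicalPhysics.QuantumFieldTheory.Balaban1983to89.B9B8KnitLetterXDiffMajorant

/-!
# `Balaban1983to89.B9Thm33DeltaATransferOfMajorants` — T. Bałaban, *Propagators for lattice gauge theories in a background field*, Commun. Math. Phys. **99**
# (1985) 389–434 [Balaban1985BackgroundPropagators], Thm 3.3 p. 399 ∕ (3.27) p. 395 ∕ (3.106) p. 414 («G = G₀(I − R)⁻¹ … R is an operator with small norm»)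
# AT TWO SITE-TRANSPORTER TABLES: if `Δ_a(U; parS₂)` is a unit whose inverse `G₂` has a (3.42)₁ block majorant `B·ℓ(a)²·e^{−δd}`, and the realified
# difference `Δ_a(U; parS₂) − Δ_a(U; parS₁)` has a block majorant `κ·ℓ(a)⁻²·e^{−δd}` with `κ` SMALL, then `Δ_a(U; parS₁)` is a unit and its inverse `G₁`
# has the (3.42)₁ majorant `B·c₁(1 − θc₁)⁻¹·ℓ(a)²·e^{−(1−α)δ′d}` — [4] Prop. 2.2 (2.50)∕(2.66) at the `Δ_a` level, in p38∕t2s-1's block-majorant currency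
# (the sup-norm twin of t2s-1's weighted bootstrap `B9B8KnitBondBootstrap`)

statement-level skeleton of published theorems with citation tags; proofs where landed; nothing here is a claim about the Yang–Mills mass gap

THE PRINT.  (3.26)–(3.27) p. 395 (`Δ_a`, `G = Δ_a⁻¹`), Thm 3.3 p. 399 (the (3.42) block of `G`), (3.106) p. 414 «For M sufficiently large this implies
G = G₀(I − R)⁻¹ = Σ G₀Rⁿ», Thm 3.11 p. 416 («symmetric and invertible»); [4] = *Propagators … II*, CMP **96** (1984), Prop. 2.2 (2.50)–(2.52) p. 232, Lemma 2.1
(2.60)–(2.61) p. 234, (2.66)–(2.67) p. 234.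

WHY THIS FILE (cell `pub-ymgap`, node N06, seat `dag-n06-j` gen 36; file 7 of the chain «Thm 3.3's block at `parKnitY` on (3.35)»).  Files 1–6 give, for every member
of the local class (3.35), the block majorant `κ_J·ℓ(a)⁻²·e^{−ρd}` of `conj b((Δ_a(U; parSymY) − Δ_a(U; parKnitY))^ℝ)` with `κ_J = O(α₀′)`
(`B9B8KnitBondWordDiffAtParsReg335` + `B9B8KnitBondResolvent.deltaAY_sub_deltaAY_eq_DPDsY_sub`); Thm 3.3's block of `G(U; parSymY)` at the member is landed
(`B9Thm310DeltaAIsUnitOfRegYP335AtLettersY`).  THIS FILE is the LETTER-FREE transfer step: `Δ₁ = Δ₂ − E`, `Δ₁G₂ = 1 − EG₂`, the realified `conj b(E)·conj b(G₂) ≺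
κBΛc₁·e^{−δ′d}` WEIGHT-FREE (the `ℓ⁻²` of `E` against the `ℓ²` of `G₂`, the middle weight moved by the transfer of `ℓ²`), hence `1 − conj b(E)conj b(G₂)` is a unit by
row sums (`B9Thm310DeltaAIsUnitOfExpansion.isUnit_one_sub_of_hasMajorant`), `Δ₁` is a unit through the coordinates (`isUnit_of_conj_mul_eq_one_sub`), and the
resolvent identity `G₁ = G₂ + G₁·E·G₂` (`B9B8KnitBondResolvent.GAY_eq_of_isUnit'`) is a fixed-point equation priced by [4] (2.66)
(`B6RandomWalk.majorant_of_fixedPoint_266`).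

WHAT IS PROVED (sorry-free; 0 `def`; any coefficient algebra `𝔸`, any two tables `(parS₁, G′₁)`, `(parS₂, G′₂)`, any bond transporter `parB`).
* §1 `conj_one'` (`conj b 1 = 1`), ★ `hasMajorant_conj_E_mul_G` (`conj b(E)·conj b(G₂) ≺ κBΛc₁·e^{−δ′d}`, weight-free).
* §2 ★★★ `isUnit_deltaAY_of_majorants` — `Δ_a(U; parS₁)` is a unit.
* §3 ★★★ `hasMajorant_conj_GAY_of_majorants` — `conj b(G(U; parS₁)^ℝ) ≺ B·c₁(δ′,α)(1 − θc₁(δ′,α))⁻¹·ℓ(a)²·e^{−(1−α)δ′d}`, `θ = κBΛc₁((1−α_st)δ, α′)`,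
  `δ′ = (1−α′)(1−α_st)δ`; ★★★ `isUnit_and_hasMajorant_GAY_of_majorants` (both, the consumer's pair).
HONEST SCOPE.  Elementary majorant algebra over landed engines; the two displayed majorants are HYPOTHESES (suppliers for `(parSymY, parKnitY)` on (3.35): files 1–6 and
`B9Thm310DeltaAIsUnitOfRegYP335AtLettersY` + the `EBlock` dictionary); helper, count-neutral; N06 NOT discharged; nothing continuum ∕ OS ∕ mass gap ∕ Clay — the
Yang–Mills mass gap is NOT proved here.  No `sorry`, no `axiom`, no `instance`, no `notation`, no `def`.  NEW file.
RELATED, NOT DUPLICATED (searched 2026-08-30: `rg -l -w "DeltaATransferOfMajorants|isUnit_deltaAY_of_majorants|hasMajorant_conj_GAY_of_majorants"` over `lean/Literature`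
= ∅): t2s-1's `B9B8KnitBondBootstrap.bootstrap ∕ deltaAFour_transfer` (the same transfer in the (3.41) weighted norms `|·|₍₋₃₎` — a different currency; this
file is the block-majorant (sup-kernel) version the N06 row-17 gap consumes), `B9B8KnitBondResolvent` (the algebra, USED BY NAME), M5.7
`B9Thm310DeltaAIsUnitOfExpansion` §1 (the Neumann device, USED BY NAME), J-B file 9 `B9B8KnitLetterMajorantTransfer` (the site-sector twin for `G′`).
-/

noncomputable section

namespace Literature.MathematicalPhysics.QuantumFieldTheory.Balaban1983to89.B9Thm33DeltaATransferOfMajorants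

open Node00
open B6KLevelCensusIndexV1 (KIdx)
open B6GlobalChartV1 (blkV1)
open B6RandomWalk (HasMajorant Triangle254 Ineq261 Ineq263 hasMajorant_mono hasMajorant_mul majorant_of_fixedPoint_266 c1_nonneg)
open B9Thm34Ext (toB6 toB6_dist)
open B9GeoNormsKLevelV1 (geo9K)
open B9GeoLemma21KLevelV1 (geo9K_dist_nonneg' geo9K_len_pos)
open B9Ineq347 (ScaleTransfer)
open B9Eq352DivFormLetters (conj conj_mul conj_sub conj_neg)
open B9Eq352GradLetters (conj_add)
open B9Thm39CinvUpperL (hasMajorant_mul_weighted)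
open B9Cor35GpCubeInputsAtOne (hasMajorant_neg)
open B9B8KnitLetterXDiffMajorant (hasMajorant_rate_mono rate_le)
open B9Thm310DeltaAIsUnitOfExpansion (isUnit_one_sub_of_hasMajorant isUnit_of_conj_mul_eq_one_sub)
open B9B8KnitBondResolvent (deltaAY_sub_deltaAY GAY_eq_of_isUnit')

variable {d ℓ : ℕ} {hd : 1 ≤ d + 1} {hL : Odd (ℓ + 1) ∧ 1 < ℓ + 1} {b₀ b₁ : ℝ}
variable (i : KIdx d ℓ hd hL b₀ b₁) {𝔸 : Type} [NormedRing 𝔸] [NormedAlgebra ℂ 𝔸] [CompleteSpace 𝔸]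
variable {ι : Type} [Fintype ι] [DecidableEq ι] (b : Module.Basis ι ℝ 𝔸)
variable [Fintype (geo9K i).Site] [DecidableEq (geo9K i).Site] {Rr : ℝ} {Hp : Prop} (ιB : BlkY i → IBondY i)

/-! ## §1 The weight-free remainder `conj b(E)·conj b(G₂)` -/

omit [CompleteSpace 𝔸] [DecidableEq ι] [Fintype (geo9K i).Site] [DecidableEq (geo9K i).Site] in
/-- `conj b 1 = 1` (the coordinate conjugation is multiplicative and unital). [cite: Balaban1984PropagatorsII, (2.52) p.232, bookkeeping] -/
theorem conj_one' : conj b (1 : Module.End ℝ (FBondY i → 𝔸)) = 1 :=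
  LinearEquiv.conj_id _

omit [Fintype ι] [DecidableEq ι] [DecidableEq (geo9K i).Site] in
/-- ★ **THE REMAINDER IS WEIGHT-FREE**: `E ≺ κ·ℓ(a)⁻²·e^{−δd}` and `G₂ ≺ B·ℓ(a)²·e^{−δd}` on the bond carrier, the transfer of `ℓ²` at `(δ, α_st, Λ)`, (2.54),
`d ≥ 0` and (2.61) at `((1−α_st)δ, α′)` give `E·G₂ ≺ κBΛc₁((1−α_st)δ,α′)·e^{−(1−α′)(1−α_st)δ·d}` — the weight `ℓ²` of the middle point moved to the left
point cancels the `ℓ⁻²` there. [cite: Balaban1984PropagatorsII, (2.52) p.232, (2.60)–(2.61) p.234, p.398 remark of Balaban1985BackgroundPropagators] -/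
theorem hasMajorant_conj_E_mul_G {E G₂ : Module.End ℝ (FBondY i × ι → ℝ)} (d₁ : ℕ) {δ αst α' Λ κ B : ℝ} (hκ : 0 ≤ κ) (hB : 0 ≤ B) (hΛ : 0 ≤ Λ)
    (hαδ : 0 ≤ αst * δ) (hα'0 : 0 ≤ α') (hα'1 : α' ≤ 1) (hδ' : 0 ≤ (1 - αst) * δ) (htri : Triangle254 (toB6 (geo9K i) Rr Hp))
    (hST : ScaleTransfer (geo9K i) δ αst Λ (fun a => (geo9K i).len a ^ 2)) (h261 : Ineq261 d₁ (toB6 (geo9K i) Rr Hp) ((1 - αst) * δ) α')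
    (hE : HasMajorant (g := toB6 (geo9K i) Rr Hp) (fun p : FBondY i × ι => ιB (blkV1 i.hN i.D p.1)) E
      (fun a a' => κ * ((geo9K i).len a ^ 2)⁻¹ * Real.exp (-(δ * (geo9K i).dist a a'))))
    (hG : HasMajorant (g := toB6 (geo9K i) Rr Hp) (fun p : FBondY i × ι => ιB (blkV1 i.hN i.D p.1)) G₂
      (fun a a' => B * (geo9K i).len a ^ 2 * Real.exp (-(δ * (geo9K i).dist a a')))) :
    HasMajorant (g := toB6 (geo9K i) Rr Hp) (fun p : FBondY i × ι => ιB (blkV1 i.hN i.D p.1)) (E * G₂)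
      (fun a a' => κ * B * Λ * B6.c1 d₁ ((1 - αst) * δ) α' * Real.exp (-((1 - α') * ((1 - αst) * δ) * (geo9K i).dist a a'))) := by
  have hw₁ : ∀ a : (geo9K i).Site, 0 ≤ ((geo9K i).len a ^ 2)⁻¹ := fun a => inv_nonneg.2 (sq_nonneg _)
  have hw₂ : ∀ a : (geo9K i).Site, 0 ≤ (geo9K i).len a ^ 2 := fun a => sq_nonneg _
  have h := hasMajorant_mul_weighted (g := geo9K i) (R := Rr) (H := Hp) (fun p : FBondY i × ι => ιB (blkV1 i.hN i.D p.1)) d₁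
    (fun a => ((geo9K i).len a ^ 2)⁻¹) (fun a => (geo9K i).len a ^ 2) hκ hB hΛ hw₁ hw₂ hαδ hα'0 hα'1 hδ' htri (geo9K_dist_nonneg' i) hST h261 hE hG
  refine hasMajorant_mono _ h fun a a' => le_of_eq ?_
  have hl : (geo9K i).len a ^ 2 ≠ 0 := pow_ne_zero 2 (geo9K_len_pos i a).ne'
  rw [inv_mul_cancel₀ hl]
  ring

/-! ## §2 ★★★ `Δ_a(U; parS₁)` is a unit -/

/-- ★★★ **INVERTIBILITY TRANSFER FOR `Δ_a` BETWEEN TWO SITE TABLES, BLOCK-MAJORANT FORM** ([B9] (3.106) «G = G₀(I − R)⁻¹, R is an operator with small norm» at the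
`Δ_a` level).  `Δ_a(U; parS₂, G′₂)` a unit; DISPLAYED on the member's bond carrier `(b, j) ↦ ιB(blkV1 b)`: the (3.42)₁ majorant `B·ℓ(a)²·e^{−δd}` of
`conj b(G(U; parS₂)^ℝ)` and the majorant `κ·ℓ(a)⁻²·e^{−δd}` of `conj b((Δ_a(U; parS₂) − Δ_a(U; parS₁))^ℝ)`; the geometry ((2.54), `d ≥ 0`, the transfer of `ℓ²`
at `(δ, α_st, Λ)`, (2.61) at `((1−α_st)δ, α′)` and at `(δ′, α)`, `δ′ = (1−α′)(1−α_st)δ`, `(1−α)δ′ ≥ 0`) and the smallness `θ·c₁(δ′,α) < 1`, `θ = κBΛc₁((1−α_st)δ,α′)`.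
THEN `Δ_a(U; parS₁, G′₁)` is a unit of `End_ℂ`: `Δ₁G₂ = 1 − EG₂`, `1 − conj b(E)conj b(G₂)` has row sums `< 1`, and the coordinates carry the unit back.
[cite: Balaban1985BackgroundPropagators, (3.26)–(3.27) p.395, (3.106) p.414, Thm 3.11 p.416; Balaban1984PropagatorsII, (2.50)–(2.52) p.232, (2.61) p.234] -/
theorem isUnit_deltaAY_of_majorants (parS₁ parS₂ : SiteParY 𝔸 i) (parB : BondParY 𝔸 i) (Gp₁ Gp₂ : SiteOpY 𝔸 i) (U : CfgY 𝔸 i)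
    (h₂ : IsUnit (deltaAY i parS₂ parB Gp₂ U))
    (d₁ d₂ : ℕ) {δ αst α' α Λ κ B : ℝ} (hκ : 0 ≤ κ) (hB : 0 ≤ B) (hΛ : 0 ≤ Λ)
    (hαδ : 0 ≤ αst * δ) (hα'0 : 0 ≤ α') (hα'1 : α' ≤ 1) (hδ' : 0 ≤ (1 - αst) * δ) (hαδ'' : 0 ≤ (1 - α) * ((1 - α') * ((1 - αst) * δ)))
    (htri : Triangle254 (toB6 (geo9K i) Rr Hp))
    (hST : ScaleTransfer (geo9K i) δ αst Λ (fun a => (geo9K i).len a ^ 2)) (h261 : Ineq261 d₁ (toB6 (geo9K i) Rr Hp) ((1 - αst) * δ) α')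
    (h261' : Ineq261 d₂ (toB6 (geo9K i) Rr Hp) ((1 - α') * ((1 - αst) * δ)) α)
    (hsmall : κ * B * Λ * B6.c1 d₁ ((1 - αst) * δ) α' * B6.c1 d₂ ((1 - α') * ((1 - αst) * δ)) α < 1)
    (hG : HasMajorant (g := toB6 (geo9K i) Rr Hp) (fun p : FBondY i × ι => ιB (blkV1 i.hN i.D p.1))
      (conj b ((GAY i parS₂ parB Gp₂ U).restrictScalars ℝ)) (fun a a' => B * (geo9K i).len a ^ 2 * Real.exp (-(δ * (geo9K i).dist a a'))))
    (hE : HasMajorant (g := toB6 (geo9K i) Rr Hp) (fun p : FBondY i × ι => ιB (blkV1 i.hN i.D p.1))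
      (conj b ((deltaAY i parS₂ parB Gp₂ U - deltaAY i parS₁ parB Gp₁ U).restrictScalars ℝ))
      (fun a a' => κ * ((geo9K i).len a ^ 2)⁻¹ * Real.exp (-(δ * (geo9K i).dist a a')))) :
    IsUnit (deltaAY i parS₁ parB Gp₁ U) := by
  set Δ₁ : Module.End ℂ (FBondY i → 𝔸) := deltaAY i parS₁ parB Gp₁ U with hΔ₁
  set Δ₂ : Module.End ℂ (FBondY i → 𝔸) := deltaAY i parS₂ parB Gp₂ U with hΔ₂
  set G₂ : Module.End ℂ (FBondY i → 𝔸) := GAY i parS₂ parB Gp₂ U with hG₂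
  have hG₂inv : Δ₂ * G₂ = 1 := Ring.mul_inverse_cancel _ h₂
  -- `Δ₁·G₂ = 1 − (Δ₂ − Δ₁)·G₂`
  have h105 : Δ₁ * G₂ = 1 - (Δ₂ - Δ₁) * G₂ := by rw [sub_mul, hG₂inv]; abel
  have h105ℝ : conj b (Δ₁.restrictScalars ℝ) * conj b (G₂.restrictScalars ℝ)
      = 1 - conj b ((Δ₂ - Δ₁).restrictScalars ℝ) * conj b (G₂.restrictScalars ℝ) := by
    rw [← B9Eq352DivFormLetters.conj_mul, ← B9Eq352DivFormLetters.conj_mul, ← conj_one' i b, ← conj_sub]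
    exact congrArg (conj b) (congrArg (LinearMap.restrictScalars ℝ) h105)
  -- the remainder is weight-free and small
  have hθ : 0 ≤ κ * B * Λ * B6.c1 d₁ ((1 - αst) * δ) α' := by have := c1_nonneg d₁ ((1 - αst) * δ) α'; positivity
  have hR := hasMajorant_conj_E_mul_G i ιB (Rr := Rr) (Hp := Hp) d₁ hκ hB hΛ hαδ hα'0 hα'1 hδ' htri hST h261 hE hG
  have hu := isUnit_one_sub_of_hasMajorant (R := Rr) (H := Hp) (fun p : FBondY i × ι => ιB (blkV1 i.hN i.D p.1)) d₂
    ((1 - α') * ((1 - αst) * δ)) α _ hθ hαδ'' (geo9K_dist_nonneg' i) h261' hsmall hR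
  exact isUnit_of_conj_mul_eq_one_sub b Δ₁ h105ℝ hu

/-! ## §3 ★★★ The (3.42)₁ majorant of `G(U; parS₁)` -/

/-- ★★★ **THM 3.3's (3.42)₁ BLOCK FOR `G(U; parS₁)` FROM THE BLOCK AT `parS₂` AND THE DIFFERENCE** ([4] Prop. 2.2 (2.66) at the `Δ_a` level): under the hypotheses
of `isUnit_deltaAY_of_majorants` plus (2.63) at `(δ′, α)` and `d(y,y) = 0`, the resolvent identity `G₁ = G₂ + G₁·(Δ₂ − Δ₁)·G₂`
(`B9B8KnitBondResolvent.GAY_eq_of_isUnit'`) is a fixed-point equation with the weight-free remainder of §1, hence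
`conj b(G(U; parS₁)^ℝ) ≺ B·c₁(δ′,α)·(1 − θc₁(δ′,α))⁻¹·ℓ(a)²·e^{−(1−α)δ′·d(a,a′)}`, `θ = κBΛc₁((1−α_st)δ,α′)`, `δ′ = (1−α′)(1−α_st)δ`.
[cite: Balaban1985BackgroundPropagators, Thm 3.3 p.399, (3.42) p.397, (3.27) p.395, (3.106) p.414; Balaban1984PropagatorsII, Prop. 2.2 (2.50)–(2.52) p.232, (2.66)–(2.67) p.234] -/
theorem hasMajorant_conj_GAY_of_majorants (parS₁ parS₂ : SiteParY 𝔸 i) (parB : BondParY 𝔸 i) (Gp₁ Gp₂ : SiteOpY 𝔸 i) (U : CfgY 𝔸 i)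
    (h₂ : IsUnit (deltaAY i parS₂ parB Gp₂ U))
    (d₁ d₂ : ℕ) {δ αst α' α Λ κ B : ℝ} (hκ : 0 ≤ κ) (hB : 0 ≤ B) (hΛ : 0 ≤ Λ)
    (hαδ : 0 ≤ αst * δ) (hα'0 : 0 ≤ α') (hα'1 : α' ≤ 1) (hδ' : 0 ≤ (1 - αst) * δ) (hαδ'' : 0 ≤ (1 - α) * ((1 - α') * ((1 - αst) * δ)))
    (htri : Triangle254 (toB6 (geo9K i) Rr Hp)) (hrefl : ∀ y : (geo9K i).Site, (geo9K i).dist y y = 0)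
    (hST : ScaleTransfer (geo9K i) δ αst Λ (fun a => (geo9K i).len a ^ 2)) (h261 : Ineq261 d₁ (toB6 (geo9K i) Rr Hp) ((1 - αst) * δ) α')
    (h261' : Ineq261 d₂ (toB6 (geo9K i) Rr Hp) ((1 - α') * ((1 - αst) * δ)) α) (h263' : Ineq263 d₂ (toB6 (geo9K i) Rr Hp) ((1 - α') * ((1 - αst) * δ)) α)
    (hsmall : κ * B * Λ * B6.c1 d₁ ((1 - αst) * δ) α' * B6.c1 d₂ ((1 - α') * ((1 - αst) * δ)) α < 1)
    (hG : HasMajorant (g := toB6 (geo9K i) Rr Hp) (fun p : FBondY i × ι => ιB (blkV1 i.hN i.D p.1))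
      (conj b ((GAY i parS₂ parB Gp₂ U).restrictScalars ℝ)) (fun a a' => B * (geo9K i).len a ^ 2 * Real.exp (-(δ * (geo9K i).dist a a'))))
    (hE : HasMajorant (g := toB6 (geo9K i) Rr Hp) (fun p : FBondY i × ι => ιB (blkV1 i.hN i.D p.1))
      (conj b ((deltaAY i parS₂ parB Gp₂ U - deltaAY i parS₁ parB Gp₁ U).restrictScalars ℝ))
      (fun a a' => κ * ((geo9K i).len a ^ 2)⁻¹ * Real.exp (-(δ * (geo9K i).dist a a')))) :
    HasMajorant (g := toB6 (geo9K i) Rr Hp) (fun p : FBondY i × ι => ιB (blkV1 i.hN i.D p.1))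
      (conj b ((GAY i parS₁ parB Gp₁ U).restrictScalars ℝ))
      (fun a a' => B * B6.c1 d₂ ((1 - α') * ((1 - αst) * δ)) α
          * (1 - κ * B * Λ * B6.c1 d₁ ((1 - αst) * δ) α' * B6.c1 d₂ ((1 - α') * ((1 - αst) * δ)) α)⁻¹
          * (geo9K i).len a ^ 2 * Real.exp (-((1 - α) * ((1 - α') * ((1 - αst) * δ)) * (geo9K i).dist a a'))) := by
  have h₁ := isUnit_deltaAY_of_majorants i b ιB (Rr := Rr) (Hp := Hp) parS₁ parS₂ parB Gp₁ Gp₂ U h₂ d₁ d₂ hκ hB hΛ hαδ hα'0 hα'1 hδ' hαδ'' htri hST h261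
    h261' hsmall hG hE
  set δ' : ℝ := (1 - α') * ((1 - αst) * δ) with hδ'def
  set θ : ℝ := κ * B * Λ * B6.c1 d₁ ((1 - αst) * δ) α' with hθdef
  have hθ : 0 ≤ θ := by have := c1_nonneg d₁ ((1 - αst) * δ) α'; positivity
  -- the fixed-point equation `conj b(G₁) = conj b(G₂) + conj b(G₁)·(conj b(Δ₂ − Δ₁)·conj b(G₂))`
  have hfixOp := GAY_eq_of_isUnit' i parS₁ parS₂ parB Gp₁ Gp₂ U h₁ h₂
  rw [← deltaAY_sub_deltaAY i parS₂ parS₁ parB Gp₂ Gp₁ U, mul_assoc] at hfixOp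
  have hfixℝ : (GAY i parS₁ parB Gp₁ U).restrictScalars ℝ = (GAY i parS₂ parB Gp₂ U).restrictScalars ℝ
      + (GAY i parS₁ parB Gp₁ U).restrictScalars ℝ
        * ((deltaAY i parS₂ parB Gp₂ U - deltaAY i parS₁ parB Gp₁ U).restrictScalars ℝ * (GAY i parS₂ parB Gp₂ U).restrictScalars ℝ) :=
    congrArg (LinearMap.restrictScalars ℝ) hfixOp
  have hfix : conj b ((GAY i parS₁ parB Gp₁ U).restrictScalars ℝ) = conj b ((GAY i parS₂ parB Gp₂ U).restrictScalars ℝ)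
      + conj b ((GAY i parS₁ parB Gp₁ U).restrictScalars ℝ)
        * (conj b ((deltaAY i parS₂ parB Gp₂ U - deltaAY i parS₁ parB Gp₁ U).restrictScalars ℝ) * conj b ((GAY i parS₂ parB Gp₂ U).restrictScalars ℝ)) := by
    rw [← B9Eq352DivFormLetters.conj_mul, ← B9Eq352DivFormLetters.conj_mul, ← conj_add]
    exact congrArg (conj b) hfixℝ
  -- the remainder (§1) and `G₂` at the rate `δ′`
  have hR := hasMajorant_conj_E_mul_G i ιB (Rr := Rr) (Hp := Hp) d₁ hκ hB hΛ hαδ hα'0 hα'1 hδ' htri hST h261 hE hG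
  have hG' := hasMajorant_rate_mono i (Rr := Rr) (Hp := Hp) (fun p : FBondY i × ι => ιB (blkV1 i.hN i.D p.1)) (fun a => (geo9K i).len a ^ 2) hB
    (fun a => sq_nonneg _) (rate_le hαδ hα'0 hδ') hG
  have h := majorant_of_fixedPoint_266 (fun p : FBondY i × ι => ιB (blkV1 i.hN i.D p.1)) d₂ δ' α θ B (fun a => (geo9K i).len a ^ 2) hB
    (fun a => sq_nonneg _) hθ hαδ'' htri hrefl (geo9K_dist_nonneg' i) h261' h263' hsmall hG' hR hfix
  refine hasMajorant_mono _ h fun a a' => le_of_eq ?_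
  simp only [hθdef, hδ'def, toB6_dist]

/-- ★★★ **THE CONSUMER's PAIR**: under the hypotheses of `hasMajorant_conj_GAY_of_majorants`, `Δ_a(U; parS₁)` is a unit AND `conj b(G(U; parS₁)^ℝ)` has the
displayed (3.42)₁ block majorant. [cite: Balaban1985BackgroundPropagators, Thm 3.3 p.399, (3.42) p.397, (3.27) p.395, (3.106) p.414, Thm 3.11 p.416] -/
theorem isUnit_and_hasMajorant_GAY_of_majorants (parS₁ parS₂ : SiteParY 𝔸 i) (parB : BondParY 𝔸 i) (Gp₁ Gp₂ : SiteOpY 𝔸 i) (U : CfgY 𝔸 i)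
    (h₂ : IsUnit (deltaAY i parS₂ parB Gp₂ U))
    (d₁ d₂ : ℕ) {δ αst α' α Λ κ B : ℝ} (hκ : 0 ≤ κ) (hB : 0 ≤ B) (hΛ : 0 ≤ Λ)
    (hαδ : 0 ≤ αst * δ) (hα'0 : 0 ≤ α') (hα'1 : α' ≤ 1) (hδ' : 0 ≤ (1 - αst) * δ) (hαδ'' : 0 ≤ (1 - α) * ((1 - α') * ((1 - αst) * δ)))
    (htri : Triangle254 (toB6 (geo9K i) Rr Hp)) (hrefl : ∀ y : (geo9K i).Site, (geo9K i).dist y y = 0)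
    (hST : ScaleTransfer (geo9K i) δ αst Λ (fun a => (geo9K i).len a ^ 2)) (h261 : Ineq261 d₁ (toB6 (geo9K i) Rr Hp) ((1 - αst) * δ) α')
    (h261' : Ineq261 d₂ (toB6 (geo9K i) Rr Hp) ((1 - α') * ((1 - αst) * δ)) α) (h263' : Ineq263 d₂ (toB6 (geo9K i) Rr Hp) ((1 - α') * ((1 - αst) * δ)) α)
    (hsmall : κ * B * Λ * B6.c1 d₁ ((1 - αst) * δ) α' * B6.c1 d₂ ((1 - α') * ((1 - αst) * δ)) α < 1)
    (hG : HasMajorant (g := toB6 (geo9K i) Rr Hp) (fun p : FBondY i × ι => ιB (blkV1 i.hN i.D p.1))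
      (conj b ((GAY i parS₂ parB Gp₂ U).restrictScalars ℝ)) (fun a a' => B * (geo9K i).len a ^ 2 * Real.exp (-(δ * (geo9K i).dist a a'))))
    (hE : HasMajorant (g := toB6 (geo9K i) Rr Hp) (fun p : FBondY i × ι => ιB (blkV1 i.hN i.D p.1))
      (conj b ((deltaAY i parS₂ parB Gp₂ U - deltaAY i parS₁ parB Gp₁ U).restrictScalars ℝ))
      (fun a a' => κ * ((geo9K i).len a ^ 2)⁻¹ * Real.exp (-(δ * (geo9K i).dist a a')))) :
    IsUnit (deltaAY i parS₁ parB Gp₁ U) ∧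
    HasMajorant (g := toB6 (geo9K i) Rr Hp) (fun p : FBondY i × ι => ιB (blkV1 i.hN i.D p.1))
      (conj b ((GAY i parS₁ parB Gp₁ U).restrictScalars ℝ))
      (fun a a' => B * B6.c1 d₂ ((1 - α') * ((1 - αst) * δ)) α
          * (1 - κ * B * Λ * B6.c1 d₁ ((1 - αst) * δ) α' * B6.c1 d₂ ((1 - α') * ((1 - αst) * δ)) α)⁻¹
          * (geo9K i).len a ^ 2 * Real.exp (-((1 - α) * ((1 - α') * ((1 - αst) * δ)) * (geo9K i).dist a a'))) :=
  ⟨isUnit_deltaAY_of_majorants i b ιB parS₁ parS₂ parB Gp₁ Gp₂ U h₂ d₁ d₂ hκ hB hΛ hαδ hα'0 hα'1 hδ' hαδ'' htri hST h261 h261' hsmall hG hE,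
    hasMajorant_conj_GAY_of_majorants i b ιB parS₁ parS₂ parB Gp₁ Gp₂ U h₂ d₁ d₂ hκ hB hΛ hαδ hα'0 hα'1 hδ' hαδ'' htri hrefl hST h261 h261' h263'
      hsmall hG hE⟩

end Literature.MathematicalPhysics.QuantumFieldTheory.Balaban1983to89.B9Thm33DeltaATransferOfMajorants

end
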